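import Literature.NumberTheory.GaloisRepresentations.ConeCochainOfFunctional
import Literature.NumberTheory.GaloisRepresentations.LiftTorsorFrame
import Literature.NumberTheory.GaloisRepresentations.NearlyOrdinaryPresentationLifts
import HarnessLib

/-!
# Vanishing of the cone obstruction gives compatible global and local lifts

Topic `Literature/NumberTheory/GaloisRepresentations`.  The deformation-theoretic input of the
relation count for nearly ordinary deformation rings (Böckle 2007, Thm. 7.6) in the cone
formulation: if the cone class `coneOb u` of a functional `u ≠ 0` on `J/𝔪J` vanishes
(`ConeCochainOfFunctional.lean`), then over the pushed-out small extension
`B_u = 𝒪⟦T⟧/(J_u + 𝔪ⁿ) ↠ R_𝒟/𝔪ⁿ` there are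

* a lift `ρ_B` of `ρ_𝒟 mod 𝔪ⁿ` with open kernel, unramified outside `S`;
* for every `v ∣ p` an upper triangular lift `ρ_v` of `localModPow v n`, a lift `P` of the
  reduced nearly ordinary frame and a section `s'`, such that the difference cochain of
  `P⁻¹ ρ_B|_{Γ_v} P` and `ρ_v` has the shape `X − s'(·) X s'(·)⁻¹` (`X ∈ M₂(I_u)`),

i.e. exactly the hypothesis `hlift` of `nearlyOrdinaryPresentation_of_lifts`
(`exists_coneLifts_of_isConeCoboundary`).  The mechanism: transport the mother section to
`B_u`, pull the `κ`-valued splitting cochains of the cone coboundary back to `M₂(I_u)` through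
the bijection `Λ_u : I_u ≅ κ` (`kerEntryLift`, `kerMatrixLift`, `eq_of_map_coeffFunPush_eq`),
build the lifts by Mazur's criterion, and evaluate the secondary identity
(`liftDiff_conjHom_liftOfCoboundary`).  Everything is proved; no named facts.

## References

* G. Böckle, *Presentations of universal deformation rings*, LMS LNS 320 (2007), Thm. 7.6.
  [cite: Bockle2007Presentations, Theorem 7.6]
* B. Mazur, *Deforming Galois representations*, MSRI Publ. 16 (1989), §1.6 Prop. 2.
  [cite: Mazur1989Deforming, §1.6 Prop. 2]
-/

noncomputable section

open scoped NumberField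
open Field IsDedekindDomain IsLocalRing Topology

namespace Literature.NumberTheory.GaloisRepresentations

/-! ## 0. Transport of comparison cochains and framed sections -/

namespace LiftingObstruction

section Transport

variable {ι : Type*} [Fintype ι] [DecidableEq ι] {A B₀ B₁ : Type*} [CommRing A] [CommRing B₀]
  [CommRing B₁] {G : Type*} [Group G]

/-- `sectionDiff` of transported sections is the transported `sectionDiff`. [folklore] -/
theorem sectionDiff_mapSection (f : B₀ →+* B₁) (s s' : GL ι A → GL ι B₀) (ρ : G →* GL ι A) (σ : G) :
    sectionDiff (mapSection f s) (mapSection f s') ρ σ = f.mapMatrix (sectionDiff s s' ρ σ) := by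
  rw [sectionDiff, sectionDiff, mapSection, mapSection, ← map_inv, ← map_mul, map_sub, map_one]
  rfl

/-- The framed section of a transported section is the transported framed section. [folklore] -/
theorem frameSection_mapSection (f : B₀ →+* B₁) (s : GL ι A → GL ι B₀) (N : GL ι A) (g : GL ι A) :
    frameSection (mapSection f s) N (mapSection f s N) g = mapSection f (frameSection s N (s N)) g := by
  simp only [frameSection, mapSection, map_mul, map_inv]

end Transport

end LiftingObstruction

namespace NearlyOrdinaryPresentationCA

open LiftingObstruction

/-! ## 1. Pulling `κ`-valued matrices back to `M₂(I_u)` -/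

section KernelLift

variable {𝒪 : Type} [CommRing 𝒪] [IsLocalRing 𝒪] {R : Type} [CommRing R] [IsLocalRing R]
  [Algebra 𝒪 R] {m : ℕ} (Θ : MvPowerSeries (Fin m) 𝒪 →ₐ[𝒪] R) (hΘ : Function.Surjective Θ)
  (n : ℕ) (hn0 : n ≠ 0)
  (u : Module.Dual (MvPowerSeries (Fin m) 𝒪 ⧸ maximalIdeal (MvPowerSeries (Fin m) 𝒪))
    (↥(RingHom.ker Θ) ⧸ (maximalIdeal (MvPowerSeries (Fin m) 𝒪) •
      (⊤ : Submodule (MvPowerSeries (Fin m) 𝒪) ↥(RingHom.ker Θ)))))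
  (hJn : RingHom.ker Θ ⊓ maximalIdeal (MvPowerSeries (Fin m) 𝒪) ^ n ≤
    maximalIdeal (MvPowerSeries (Fin m) 𝒪) * RingHom.ker Θ)

/-- The residue map `B_u → κ`. [folklore] -/
def pushResidue : (MvPowerSeries (Fin m) 𝒪 ⧸ pushoutTruncIdeal Θ u n) →+*
    MvPowerSeries (Fin m) 𝒪 ⧸ maximalIdeal (MvPowerSeries (Fin m) 𝒪) :=
  Ideal.Quotient.factor (pushoutTruncIdeal_le_maximalIdeal Θ u n hn0)

/-- `pushResidue` on residue classes. [folklore] -/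
@[simp] theorem pushResidue_mk (x : MvPowerSeries (Fin m) 𝒪) :
    pushResidue Θ n hn0 u (Ideal.Quotient.mk (pushoutTruncIdeal Θ u n) x) =
      Ideal.Quotient.mk (maximalIdeal (MvPowerSeries (Fin m) 𝒪)) x :=
  rfl

/-- `pushResidue ∘ (B₀ → B_u) = motherResidue`. [folklore] -/
theorem pushResidue_toPushout (x : MvPowerSeries (Fin m) 𝒪 ⧸ motherIdeal Θ n) :
    pushResidue Θ n hn0 u (toPushout Θ n u x) = motherResidue Θ n hn0 x := by
  obtain ⟨x, rfl⟩ := Ideal.Quotient.mk_surjective x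
  rfl

omit [IsLocalRing R] in
/-- `B₀ → B_u` is onto. [folklore] -/
theorem toPushout_surjective : Function.Surjective (toPushout Θ n u) := by
  intro y
  obtain ⟨x, rfl⟩ := Ideal.Quotient.mk_surjective y
  exact ⟨Ideal.Quotient.mk _ x, rfl⟩

/-- `pushResidue = resA ∘ q_u`. [folklore] -/
theorem pushResidue_eq_resA_comp :
    pushResidue Θ n hn0 u = (resA Θ hΘ n hn0).comp
      (quRaw Θ hΘ u n : (MvPowerSeries (Fin m) 𝒪 ⧸ pushoutTruncIdeal Θ u n) →+* R ⧸ maximalIdeal R ^ n) := by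
  refine Ideal.Quotient.ringHom_ext (RingHom.ext fun x => ?_)
  change pushResidue Θ n hn0 u (Ideal.Quotient.mk _ x) =
    resA Θ hΘ n hn0 (quRaw Θ hΘ u n (Ideal.Quotient.mk (pushoutTruncIdeal Θ u n) x))
  rw [pushResidue_mk, quRaw_mk, resA_mk_apply]

include hJn in
/-- **`Λ_u` on `B_u` is kernel-semilinear** (transfer from the mother extension).
[cite: Mazur1989Deforming, §1.6 Prop. 2] -/
theorem isKernelSemilinear_coeffFunPush :
    IsKernelSemilinear
      (φ := (quRaw Θ hΘ u n : (MvPowerSeries (Fin m) 𝒪 ⧸ pushoutTruncIdeal Θ u n) →+* R ⧸ maximalIdeal R ^ n))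
      (pushResidue Θ n hn0 u) (coeffFunPush Θ n u) := by
  refine (isKernelSemilinear_coeffFun Θ hΘ n u hJn hn0).of_comp_surjective
    ((toPushout Θ n u : (MvPowerSeries (Fin m) 𝒪 ⧸ motherIdeal Θ n) →ₐ[𝒪]
      (MvPowerSeries (Fin m) 𝒪 ⧸ pushoutTruncIdeal Θ u n)) : _ →+* _)
    (toPushout_surjective Θ n u) (fun x => ?_) (fun x => pushResidue_toPushout Θ n hn0 u x)
    (fun x => coeffFunPush_toPushout Θ n u hJn x)
  change quRaw Θ hΘ u n (toPushout Θ n u x) = q0Raw Θ hΘ n x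
  rw [← AlgHom.comp_apply, quRaw_comp_toPushout]

/-- Kernel elements of `q_u` are classes of elements of `J + 𝔪ⁿ`. [folklore] -/
theorem exists_mk_eq_of_quRaw_eq_zero {x : MvPowerSeries (Fin m) 𝒪 ⧸ pushoutTruncIdeal Θ u n}
    (hx : quRaw Θ hΘ u n x = 0) :
    ∃ y ∈ RingHom.ker Θ ⊔ maximalIdeal (MvPowerSeries (Fin m) 𝒪) ^ n,
      Ideal.Quotient.mk (pushoutTruncIdeal Θ u n) y = x := by
  obtain ⟨y, rfl⟩ := Ideal.Quotient.mk_surjective x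
  exact ⟨y, (quRaw_mk_eq_zero_iff Θ hΘ u n y).mp hx, rfl⟩

include hn0 hJn in
/-- **`Λ_u` is injective on `ker q_u`.** [cite: Mazur1989Deforming, §1.6 Prop. 2] -/
theorem eq_of_coeffFunPush_eq {x y : MvPowerSeries (Fin m) 𝒪 ⧸ pushoutTruncIdeal Θ u n}
    (hx : quRaw Θ hΘ u n x = 0) (hy : quRaw Θ hΘ u n y = 0)
    (h : coeffFunPush Θ n u x = coeffFunPush Θ n u y) : x = y := by
  have hΛ := isKernelSemilinear_coeffFunPush Θ hΘ n hn0 u hJn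
  have hxy : quRaw Θ hΘ u n (x - y) = 0 := by rw [map_sub, hx, hy, sub_zero]
  have hadd := hΛ.map_add (x - y) y ((RingHom.mem_ker).mpr hxy) ((RingHom.mem_ker).mpr hy)
  rw [sub_add_cancel, h] at hadd
  have h0 : coeffFunPush Θ n u (x - y) = 0 := by simpa using hadd.symm
  obtain ⟨c, hc, hcx⟩ := exists_mk_eq_of_quRaw_eq_zero Θ hΘ n u hxy
  rw [← hcx, coeffFunPush_mk_eq_zero_iff Θ n u hJn hc] at h0
  rw [← sub_eq_zero, ← hcx, h0]

open scoped Classical in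
/-- **A preimage in `ker q_u` of `t ∈ κ` under `Λ_u`** (`0 ↦ 0`; requires `u ≠ 0`).
[cite: Mazur1989Deforming, §1.6 Prop. 2] -/
def kerEntryLift (hu : u ≠ 0) (t : MvPowerSeries (Fin m) 𝒪 ⧸ maximalIdeal (MvPowerSeries (Fin m) 𝒪)) :
    MvPowerSeries (Fin m) 𝒪 ⧸ pushoutTruncIdeal Θ u n :=
  if t = 0 then 0 else
    Ideal.Quotient.mk (pushoutTruncIdeal Θ u n)
      ((Classical.choose (coeffFunPush_surjective Θ n u hJn hu t) : ↥(RingHom.ker Θ)) :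
        MvPowerSeries (Fin m) 𝒪)

omit [IsLocalRing R] in
/-- `kerEntryLift 0 = 0`. [folklore] -/
@[simp] theorem kerEntryLift_zero (hu : u ≠ 0) : kerEntryLift Θ n u hJn hu 0 = 0 := by
  classical
  unfold kerEntryLift
  rw [if_pos rfl]

/-- `kerEntryLift t ∈ ker q_u`. [folklore] -/
theorem quRaw_kerEntryLift (hu : u ≠ 0) (t : MvPowerSeries (Fin m) 𝒪 ⧸ maximalIdeal (MvPowerSeries (Fin m) 𝒪)) :
    quRaw Θ hΘ u n (kerEntryLift Θ n u hJn hu t) = 0 := by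
  classical
  unfold kerEntryLift
  split_ifs with ht
  · exact map_zero _
  · rw [quRaw_mk, Ideal.Quotient.eq_zero_iff_mem]
    have hj := (Classical.choose (coeffFunPush_surjective Θ n u hJn hu t)).2
    rw [RingHom.mem_ker] at hj
    rw [hj]
    exact Ideal.zero_mem _

omit [IsLocalRing R] in
/-- **`Λ_u (kerEntryLift t) = t`.** [cite: Mazur1989Deforming, §1.6 Prop. 2] -/
theorem coeffFunPush_kerEntryLift (hu : u ≠ 0)
    (t : MvPowerSeries (Fin m) 𝒪 ⧸ maximalIdeal (MvPowerSeries (Fin m) 𝒪)) :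
    coeffFunPush Θ n u (kerEntryLift Θ n u hJn hu t) = t := by
  classical
  unfold kerEntryLift
  split_ifs with ht
  · rw [ht]
    have h := coeffFunPush_mk Θ n u hJn 0 0 (Ideal.zero_mem _)
    simp only [ZeroMemClass.coe_zero, add_zero, map_zero, Submodule.Quotient.mk_zero] at h
    exact h
  · exact Classical.choose_spec (coeffFunPush_surjective Θ n u hJn hu t)

/-- **Pull-back of a `κ`-valued matrix to `M₂(I_u)`** (entrywise `kerEntryLift`).
[cite: Mazur1989Deforming, §1.6 Prop. 2] -/
def kerMatrixLift (hu : u ≠ 0) {ι : Type*}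
    (Y : Matrix ι ι (MvPowerSeries (Fin m) 𝒪 ⧸ maximalIdeal (MvPowerSeries (Fin m) 𝒪))) :
    Matrix ι ι (MvPowerSeries (Fin m) 𝒪 ⧸ pushoutTruncIdeal Θ u n) :=
  Y.map (kerEntryLift Θ n u hJn hu)

/-- `kerMatrixLift Y ∈ M(I_u)`. [folklore] -/
theorem kerMatrixLift_mem (hu : u ≠ 0) {ι : Type*} [Fintype ι] [DecidableEq ι]
    (Y : Matrix ι ι (MvPowerSeries (Fin m) 𝒪 ⧸ maximalIdeal (MvPowerSeries (Fin m) 𝒪))) :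
    kerMatrixLift Θ n u hJn hu Y ∈ kerMatrix
      (quRaw Θ hΘ u n : (MvPowerSeries (Fin m) 𝒪 ⧸ pushoutTruncIdeal Θ u n) →+* R ⧸ maximalIdeal R ^ n) := by
  rw [mem_kerMatrix_iff]
  intro i j
  exact quRaw_kerEntryLift Θ hΘ n u hJn hu _

omit [IsLocalRing R] in
/-- `Λ_u (kerMatrixLift Y) = Y`. [folklore] -/
@[simp] theorem map_coeffFunPush_kerMatrixLift (hu : u ≠ 0) {ι : Type*}
    (Y : Matrix ι ι (MvPowerSeries (Fin m) 𝒪 ⧸ maximalIdeal (MvPowerSeries (Fin m) 𝒪))) :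
    (kerMatrixLift Θ n u hJn hu Y).map (coeffFunPush Θ n u) = Y := by
  ext i j
  simp only [kerMatrixLift, Matrix.map_apply, coeffFunPush_kerEntryLift]

omit [IsLocalRing R] in
/-- `kerMatrixLift` preserves block shapes. [folklore] -/
theorem blockTriangular_kerMatrixLift (hu : u ≠ 0) {ι : Type*} {α : Type*} [LT α] {b : ι → α}
    {Y : Matrix ι ι (MvPowerSeries (Fin m) 𝒪 ⧸ maximalIdeal (MvPowerSeries (Fin m) 𝒪))}
    (hY : Y.BlockTriangular b) : (kerMatrixLift Θ n u hJn hu Y).BlockTriangular b := fun i j hij => by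
  rw [kerMatrixLift, Matrix.map_apply, hY hij, kerEntryLift_zero]

include hn0 hJn in
/-- **`Λ_u` is injective on kernel matrices.** [cite: Mazur1989Deforming, §1.6 Prop. 2] -/
theorem eq_of_map_coeffFunPush_eq {ι : Type*} [Fintype ι] [DecidableEq ι]
    {X X' : Matrix ι ι (MvPowerSeries (Fin m) 𝒪 ⧸ pushoutTruncIdeal Θ u n)}
    (hX : X ∈ kerMatrix (quRaw Θ hΘ u n : (MvPowerSeries (Fin m) 𝒪 ⧸ pushoutTruncIdeal Θ u n) →+*
      R ⧸ maximalIdeal R ^ n))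
    (hX' : X' ∈ kerMatrix (quRaw Θ hΘ u n : (MvPowerSeries (Fin m) 𝒪 ⧸ pushoutTruncIdeal Θ u n) →+*
      R ⧸ maximalIdeal R ^ n))
    (h : X.map (coeffFunPush Θ n u) = X'.map (coeffFunPush Θ n u)) : X = X' := by
  ext i j
  exact eq_of_coeffFunPush_eq Θ hΘ n hn0 u hJn ((mem_kerMatrix_iff _).mp hX i j)
    ((mem_kerMatrix_iff _).mp hX' i j) (by simpa using congrFun (congrFun h i) j)

end KernelLift

/-! ## 2. The transported section over `B_u` -/

section Transported

variable {F : Type} [Field F] [NumberField F] {p : ℕ} {𝒪 : Type} [CommRing 𝒪] [IsLocalRing 𝒪]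
  {k : Type} [Field k] [Algebra 𝒪 k] {𝒟 : NearlyOrdinaryDatum F p 𝒪 k}
  (𝓡 : NearlyOrdinaryDeformationRing.{0} 𝒟)
  {m : ℕ} (Θ : MvPowerSeries (Fin m) 𝒪 →ₐ[𝒪] 𝓡.R) (hΘ : Function.Surjective Θ)
  (n : ℕ) (hn0 : n ≠ 0)
  (u : Module.Dual (MvPowerSeries (Fin m) 𝒪 ⧸ maximalIdeal (MvPowerSeries (Fin m) 𝒪))
    (↥(RingHom.ker Θ) ⧸ (maximalIdeal (MvPowerSeries (Fin m) 𝒪) •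
      (⊤ : Submodule (MvPowerSeries (Fin m) 𝒪) ↥(RingHom.ker Θ)))))
  (hJn : RingHom.ker Θ ⊓ maximalIdeal (MvPowerSeries (Fin m) 𝒪) ^ n ≤
    maximalIdeal (MvPowerSeries (Fin m) 𝒪) * RingHom.ker Θ)

/-- `B₀ → B_u` as a ring homomorphism. [folklore] -/
abbrev fu : (MvPowerSeries (Fin m) 𝒪 ⧸ motherIdeal Θ n) →+* (MvPowerSeries (Fin m) 𝒪 ⧸ pushoutTruncIdeal Θ u n) :=
  (toPushout Θ n u : (MvPowerSeries (Fin m) 𝒪 ⧸ motherIdeal Θ n) →ₐ[𝒪]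
    (MvPowerSeries (Fin m) 𝒪 ⧸ pushoutTruncIdeal Θ u n))

/-- `q_u` as a ring homomorphism. [folklore] -/
abbrev quHom : (MvPowerSeries (Fin m) 𝒪 ⧸ pushoutTruncIdeal Θ u n) →+* 𝓡.R ⧸ maximalIdeal 𝓡.R ^ n :=
  (quRaw Θ hΘ u n : (MvPowerSeries (Fin m) 𝒪 ⧸ pushoutTruncIdeal Θ u n) →ₐ[𝒪] 𝓡.R ⧸ maximalIdeal 𝓡.R ^ n)

/-- `q_u ∘ (B₀ → B_u) = q₀` (ring homomorphisms). [folklore] -/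
theorem quHom_comp_fu : (quHom 𝓡 Θ hΘ n u).comp (fu 𝓡 Θ n u) = q0Hom 𝓡 Θ hΘ n := by
  refine RingHom.ext fun x => ?_
  change quRaw Θ hΘ u n (toPushout Θ n u x) = q0Raw Θ hΘ n x
  rw [← AlgHom.comp_apply, quRaw_comp_toPushout]

include hn0 in
/-- `ker q_u` has square zero (ring-hom form). [folklore] -/
theorem quHom_sqZero : ∀ x ∈ RingHom.ker (quHom 𝓡 Θ hΘ n u), ∀ y ∈ RingHom.ker (quHom 𝓡 Θ hΘ n u),
    x * y = 0 := fun x hx y hy =>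
  quRaw_sqZero Θ hΘ u n hn0 x y ((RingHom.mem_ker).mp hx) ((RingHom.mem_ker).mp hy)

/-- **The transported section `s_u = GL₂(B₀ → B_u) ∘ s₀`.** [cite: Mazur1989Deforming, §1.6 Prop. 2] -/
def su : GL (Fin 2) (𝓡.R ⧸ maximalIdeal 𝓡.R ^ n) → GL (Fin 2) (MvPowerSeries (Fin m) 𝒪 ⧸ pushoutTruncIdeal Θ u n) :=
  mapSection (fu 𝓡 Θ n u) (s0 𝓡 Θ hΘ n hn0)

/-- `s_u` is a section of `GL₂(q_u)`. [folklore] -/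
theorem map_su (g : GL (Fin 2) (𝓡.R ⧸ maximalIdeal 𝓡.R ^ n)) :
    Matrix.GeneralLinearGroup.map (quHom 𝓡 Θ hΘ n u) (su 𝓡 Θ hΘ n hn0 u g) = g :=
  map_mapSection (fu 𝓡 Θ n u) (quHom_comp_fu 𝓡 Θ hΘ n u) (map_s0 𝓡 Θ hΘ n hn0) g

/-- `s_u` is compatible with every block pattern. [folklore] -/
theorem su_mem_parabolicGL {α : Type*} [LinearOrder α] (b : Fin 2 → α)
    (g : GL (Fin 2) (𝓡.R ⧸ maximalIdeal 𝓡.R ^ n)) (hg : g ∈ parabolicGL b (𝓡.R ⧸ maximalIdeal 𝓡.R ^ n)) :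
    su 𝓡 Θ hΘ n hn0 u g ∈ parabolicGL b (MvPowerSeries (Fin m) 𝒪 ⧸ pushoutTruncIdeal Θ u n) :=
  mapSection_mem_parabolicGL b (fu 𝓡 Θ n u) (fun g hg => s0_mem_parabolicGL 𝓡 Θ hΘ n hn0 b g hg) g hg

/-- `GL₂(res_u)(s_u g) = GL₂(resA)(g)`. [folklore] -/
theorem map_pushResidue_su (g : GL (Fin 2) (𝓡.R ⧸ maximalIdeal 𝓡.R ^ n)) :
    Matrix.GeneralLinearGroup.map (pushResidue Θ n hn0 u) (su 𝓡 Θ hΘ n hn0 u g) =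
      Matrix.GeneralLinearGroup.map (resA Θ hΘ n hn0) g := by
  have hcomp : (pushResidue Θ n hn0 u).comp (fu 𝓡 Θ n u) = motherResidue Θ n hn0 :=
    RingHom.ext fun x => pushResidue_toPushout Θ n hn0 u x
  rw [su, mapSection, ← Matrix.GeneralLinearGroup.map_comp_apply, ← Matrix.GeneralLinearGroup.map_comp,
    hcomp, map_motherResidue_s0]

include hJn in
/-- `Λ_u ∘ (B₀ → B_u) = Λ₀` entrywise on matrices. [folklore] -/
theorem map_coeffFunPush_mapMatrix {ι : Type*} [Fintype ι] [DecidableEq ι]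
    (X : Matrix ι ι (MvPowerSeries (Fin m) 𝒪 ⧸ motherIdeal Θ n)) :
    ((fu 𝓡 Θ n u).mapMatrix X).map (coeffFunPush Θ n u) = X.map (coeffFun Θ n u) := by
  ext i j
  simp only [RingHom.mapMatrix_apply, Matrix.map_apply]
  exact coeffFunPush_toPushout Θ n u hJn _

include hJn in
/-- The `Λ_u`-image of the transported defect is the `Λ₀`-image of the mother defect. [folklore] -/
theorem map_liftDefect_su {G : Type*} [Group G] (ρ : G →* GL (Fin 2) (𝓡.R ⧸ maximalIdeal 𝓡.R ^ n))
    (σ τ : G) :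
    (liftDefect (su 𝓡 Θ hΘ n hn0 u) ρ σ τ).map (coeffFunPush Θ n u) =
      (liftDefect (s0 𝓡 Θ hΘ n hn0) ρ σ τ).map (coeffFun Θ n u) := by
  rw [su, liftDefect_mapSection, map_coeffFunPush_mapMatrix 𝓡 Θ n u hJn]

include hJn in
/-- The `Λ_u`-image of the transported comparison cochain with the framed section is the
`Λ₀`-image of the mother one. [folklore] -/
theorem map_sectionDiff_su (v : PlacesAbove F p) (σ : absoluteGaloisGroup (v.1.adicCompletion F)) :
    (sectionDiff (su 𝓡 Θ hΘ n hn0 u)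
        (frameSection (su 𝓡 Θ hΘ n hn0 u) (𝓡.noFrameModPow v.1 n)
          (su 𝓡 Θ hΘ n hn0 u (𝓡.noFrameModPow v.1 n)))
        (𝓡.localModPow v.1 n) σ).map (coeffFunPush Θ n u) =
      (sectionDiff (s0 𝓡 Θ hΘ n hn0) (s0Framed 𝓡 Θ hΘ n hn0 v) (𝓡.localModPow v.1 n) σ).map
        (coeffFun Θ n u) := by
  have hfr : frameSection (su 𝓡 Θ hΘ n hn0 u) (𝓡.noFrameModPow v.1 n)
      (su 𝓡 Θ hΘ n hn0 u (𝓡.noFrameModPow v.1 n)) = mapSection (fu 𝓡 Θ n u) (s0Framed 𝓡 Θ hΘ n hn0 v) :=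
    funext fun g => frameSection_mapSection (fu 𝓡 Θ n u) (s0 𝓡 Θ hΘ n hn0) _ g
  rw [hfr, su, sectionDiff_mapSection, map_coeffFunPush_mapMatrix 𝓡 Θ n u hJn]

end Transported

/-! ## 3. Vanishing of the cone obstruction ⇒ compatible lifts -/

section Vanishing

variable {F : Type} [Field F] [NumberField F] {p : ℕ} {𝒪 : Type} [CommRing 𝒪] [IsLocalRing 𝒪]
  {k : Type} [Field k] [Algebra 𝒪 k] {𝒟 : NearlyOrdinaryDatum F p 𝒪 k}
  (𝓡 : NearlyOrdinaryDeformationRing.{0} 𝒟)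
  {m : ℕ} (Θ : MvPowerSeries (Fin m) 𝒪 →ₐ[𝒪] 𝓡.R) (hΘ : Function.Surjective Θ)
  (n : ℕ) (hn0 : n ≠ 0)
  (u : Module.Dual (MvPowerSeries (Fin m) 𝒪 ⧸ maximalIdeal (MvPowerSeries (Fin m) 𝒪))
    (↥(RingHom.ker Θ) ⧸ (maximalIdeal (MvPowerSeries (Fin m) 𝒪) •
      (⊤ : Submodule (MvPowerSeries (Fin m) 𝒪) ↥(RingHom.ker Θ)))))
  (hJn : RingHom.ker Θ ⊓ maximalIdeal (MvPowerSeries (Fin m) 𝒪) ^ n ≤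
    maximalIdeal (MvPowerSeries (Fin m) 𝒪) * RingHom.ker Θ)
  (hu : u ≠ 0)

include hJn in
/-- **Splitting the transported defect.**  If the `Λ₀`-image of the mother defect of `ρ` splits
by a continuous `κ`-valued cochain `a` (for the conjugation action of `r = GL₂(resA) ∘ ρ`), then
the defect of `ρ` for the transported section `s_u` splits by `kerMatrixLift ∘ a`.
[cite: Mazur1989Deforming, §1.6 Prop. 2] -/
theorem liftDefect_su_eq_coboundary {G : Type*} [Group G]
    (ρ : G →* GL (Fin 2) (𝓡.R ⧸ maximalIdeal 𝓡.R ^ n))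
    (a : G → Matrix (Fin 2) (Fin 2) (MvPowerSeries (Fin m) 𝒪 ⧸ maximalIdeal (MvPowerSeries (Fin m) 𝒪)))
    (ha : ∀ σ τ, (liftDefect (s0 𝓡 Θ hΘ n hn0) ρ σ τ).map (coeffFun Θ n u) =
      conjLin (Matrix.GeneralLinearGroup.map (resA Θ hΘ n hn0) (ρ σ)) (a τ) - a (σ * τ) + a σ)
    (σ τ : G) :
    liftDefect (su 𝓡 Θ hΘ n hn0 u) ρ σ τ =
      (su 𝓡 Θ hΘ n hn0 u (ρ σ) : Matrix (Fin 2) (Fin 2) _) * kerMatrixLift Θ n u hJn hu (a τ) *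
          (((su 𝓡 Θ hΘ n hn0 u (ρ σ))⁻¹ : GL (Fin 2) _) : Matrix (Fin 2) (Fin 2) _) -
        kerMatrixLift Θ n u hJn hu (a (σ * τ)) + kerMatrixLift Θ n u hJn hu (a σ) := by
  have hΛ := isKernelSemilinear_coeffFunPush Θ hΘ n hn0 u hJn
  have hs := map_su 𝓡 Θ hΘ n hn0 u
  have hmem := kerMatrixLift_mem Θ hΘ n u hJn hu (ι := Fin 2)
  have hconj : (su 𝓡 Θ hΘ n hn0 u (ρ σ) : Matrix (Fin 2) (Fin 2) _) * kerMatrixLift Θ n u hJn hu (a τ) *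
      (((su 𝓡 Θ hΘ n hn0 u (ρ σ))⁻¹ : GL (Fin 2) _) : Matrix (Fin 2) (Fin 2) _) ∈
        kerMatrix (quHom 𝓡 Θ hΘ n u) :=
    mul_mem_kerMatrix_right _ (mul_mem_kerMatrix_left _ (hmem _))
  refine eq_of_map_coeffFunPush_eq Θ hΘ n hn0 u hJn (liftDefect_mem hs ρ σ τ)
    ((kerMatrix _).add_mem ((kerMatrix _).sub_mem hconj (hmem _)) (hmem _)) ?_
  rw [map_liftDefect_su 𝓡 Θ hΘ n hn0 u hJn, ha,
    map_add_of_mem_kerMatrix hΛ ((kerMatrix _).sub_mem hconj (hmem _)) (hmem _),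
    map_sub_of_mem_kerMatrix hΛ hconj (hmem _), map_conj_of_mem_kerMatrix hΛ _ (hmem _),
    map_pushResidue_su, map_coeffFunPush_kerMatrixLift, map_coeffFunPush_kerMatrixLift,
    map_coeffFunPush_kerMatrixLift]

include hJn hu in
/-- **Vanishing of the cone obstruction gives compatible lifts** (the hypothesis `hlift` of
`nearlyOrdinaryPresentation_of_lifts`, over the raw model of `B_u`).
[cite: Bockle2007Presentations, Theorem 7.6] -/
theorem exists_coneLifts_of_isConeCoboundary
    (hcob : IsConeCoboundary (residualK 𝓡 Θ hΘ n hn0)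
      (fun v : PlacesAbove F p => absoluteGaloisGroup (v.1.adicCompletion F)) (coneι 𝒟)
      (fun v : PlacesAbove F p => localResidualK 𝓡 Θ hΘ n hn0 v.1) (id : Fin 2 → Fin 2)
      (coneFrame 𝓡 Θ hΘ n hn0) (coneCochainOf 𝓡 Θ hΘ n hn0 u)) :
    ∃ ρB : absoluteGaloisGroup F →* GL (Fin 2) (MvPowerSeries (Fin m) 𝒪 ⧸ pushoutTruncIdeal Θ u n),
      (∀ σ, Matrix.GeneralLinearGroup.map (quHom 𝓡 Θ hΘ n u) (ρB σ) = 𝓡.modPow n σ) ∧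
      IsOpen ((ρB.ker : Subgroup (absoluteGaloisGroup F)) : Set (absoluteGaloisGroup F)) ∧
      (∀ v ∉ 𝒟.S, Deformation.IsUnramifiedAt v ρB) ∧
      ∀ v : HeightOneSpectrum (𝓞 F), (p : 𝓞 F) ∈ v.asIdeal →
        ∃ (P : GL (Fin 2) (MvPowerSeries (Fin m) 𝒪 ⧸ pushoutTruncIdeal Θ u n))
          (_ : Matrix.GeneralLinearGroup.map (quHom 𝓡 Θ hΘ n u) P = 𝓡.noFrameModPow v n)
          (s' : GL (Fin 2) (𝓡.R ⧸ maximalIdeal 𝓡.R ^ n) →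
            GL (Fin 2) (MvPowerSeries (Fin m) 𝒪 ⧸ pushoutTruncIdeal Θ u n))
          (_ : ∀ g, Matrix.GeneralLinearGroup.map (quHom 𝓡 Θ hΘ n u) (s' g) = g)
          (ρv : absoluteGaloisGroup (v.adicCompletion F) →*
            GL (Fin 2) (MvPowerSeries (Fin m) 𝒪 ⧸ pushoutTruncIdeal Θ u n))
          (e : absoluteGaloisGroup (v.adicCompletion F) →
            Matrix (Fin 2) (Fin 2) (MvPowerSeries (Fin m) 𝒪 ⧸ pushoutTruncIdeal Θ u n))
          (X : Matrix (Fin 2) (Fin 2) (MvPowerSeries (Fin m) 𝒪 ⧸ pushoutTruncIdeal Θ u n)),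
          (∀ σ, Matrix.GeneralLinearGroup.map (quHom 𝓡 Θ hΘ n u) (ρv σ) = 𝓡.localModPow v n σ) ∧
          (∀ σ, (ρv σ : Matrix (Fin 2) (Fin 2) (MvPowerSeries (Fin m) 𝒪 ⧸ pushoutTruncIdeal Θ u n)) 1 0 = 0) ∧
          (∀ σ, e σ ∈ kerParabolic (id : Fin 2 → Fin 2) (quHom 𝓡 Θ hΘ n u)) ∧
          X ∈ kerMatrix (quHom 𝓡 Θ hΘ n u) ∧
          ∀ σ, liftDiff ρv (NearlyOrdinaryDeformationRing.conjLocal P ρB v) σ =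
            e σ + (X - (s' (𝓡.localModPow v n σ) : Matrix (Fin 2) (Fin 2) (MvPowerSeries (Fin m) 𝒪 ⧸ pushoutTruncIdeal Θ u n)) * X *
              ((s' (𝓡.localModPow v n σ))⁻¹ : GL (Fin 2) (MvPowerSeries (Fin m) 𝒪 ⧸ pushoutTruncIdeal Θ u n))) := by
  obtain ⟨a, hac, av, havc, havP, w, hga, hloc⟩ := hcob
  have hΛ := isKernelSemilinear_coeffFunPush Θ hΘ n hn0 u hJn
  have hs := map_su 𝓡 Θ hΘ n hn0 u
  have hI := quHom_sqZero 𝓡 Θ hΘ n hn0 u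
  have hmem := kerMatrixLift_mem Θ hΘ n u hJn hu (ι := Fin 2)
  -- (1) the global lift on `G_{F,S}`
  have hga' : ∀ σ τ, (liftDefect (s0 𝓡 Θ hΘ n hn0) (𝓡.modPowQuot n) σ τ).map (coeffFun Θ n u) =
      conjLin (Matrix.GeneralLinearGroup.map (resA Θ hΘ n hn0) (𝓡.modPowQuot n σ)) (a τ) -
        a (σ * τ) + a σ := fun σ τ => hga σ τ
  have hcobB := liftDefect_su_eq_coboundary 𝓡 Θ hΘ n hn0 u hJn hu (𝓡.modPowQuot n) a hga'
  set ρBQ := liftOfCoboundary hs hI (𝓡.modPowQuot n) (fun σ => kerMatrixLift Θ n u hJn hu (a σ))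
    (fun σ => hmem (a σ)) hcobB with hρBQ
  have hblc : IsLocallyConstant fun σ => kerMatrixLift Θ n u hJn hu (a σ) :=
    ((IsLocallyConstant.iff_continuous a).mpr hac).comp (kerMatrixLift Θ n u hJn hu)
  have hopenQ := isOpen_ker_liftOfCoboundary hI hs (𝓡.modPowQuot n) (𝓡.isOpen_ker_modPowQuot n)
    _ (fun σ => hmem (a σ)) hcobB hblc
  refine ⟨ρBQ.comp (toUnramifiedQuot F 𝒟.S), fun σ => ?_, isOpen_ker_comp_mk ρBQ hopenQ,
    fun v hv 𝔓 h𝔓 σ hσ => comp_mk_unramified ρBQ hv h𝔓 hσ, fun v hv => ?_⟩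
  · rw [MonoidHom.comp_apply, map_liftOfCoboundary, NearlyOrdinaryDeformationRing.modPowQuot_mk]
  -- (2) the local lift at `v ∣ p`
  set V : PlacesAbove F p := ⟨v, hv⟩ with hVdef
  set ρ' := 𝓡.localModPow v n with hρ'def
  set N := 𝓡.noFrameModPow v n with hNdef
  obtain ⟨hlc1, hlc2⟩ := hloc V
  have hla' : ∀ σ τ, (liftDefect (s0 𝓡 Θ hΘ n hn0) ρ' σ τ).map (coeffFun Θ n u) =
      conjLin (Matrix.GeneralLinearGroup.map (resA Θ hΘ n hn0) (ρ' σ)) (av V τ) -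
        av V (σ * τ) + av V σ := fun σ τ => hlc1 σ τ
  have hcobv := liftDefect_su_eq_coboundary 𝓡 Θ hΘ n hn0 u hJn hu ρ' (av V) hla'
  have hmemP : ∀ σ, kerMatrixLift Θ n u hJn hu (av V σ) ∈
      kerParabolic (id : Fin 2 → Fin 2) (quHom 𝓡 Θ hΘ n u) := fun σ =>
    ⟨hmem _, blockTriangular_kerMatrixLift Θ n u hJn hu (havP V σ)⟩
  set ρv := liftOfCoboundary hs hI ρ' (fun σ => kerMatrixLift Θ n u hJn hu (av V σ))
    (fun σ => hmem (av V σ)) hcobv with hρv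
  have hρvB : ∀ σ, ρv σ ∈ parabolicGL (id : Fin 2 → Fin 2) (MvPowerSeries (Fin m) 𝒪 ⧸ pushoutTruncIdeal Θ u n) :=
    fun σ => liftOfCoboundary_mem_parabolicGL id hs
      (fun g hg => su_mem_parabolicGL 𝓡 Θ hΘ n hn0 u id g hg) ρ'
      (fun σ => 𝓡.localModPow_mem_borel v hv n σ) hI _ hmemP hcobv σ
  set P := su 𝓡 Θ hΘ n hn0 u N with hPdef
  set wt := kerMatrixLift Θ n u hJn hu (w V) with hwt
  refine ⟨P, hs N, su 𝓡 Θ hΘ n hn0 u, hs, ρv, fun _ => 0, -wt, fun σ => map_liftOfCoboundary _ _ _ _ _ _ σ,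
    fun σ => (mem_parabolicGL_id_fin_two_iff _).mp (hρvB σ), fun _ => zero_mem _, neg_mem (hmem _),
    fun σ => ?_⟩
  -- (3) the secondary identity
  have hconjLocal : NearlyOrdinaryDeformationRing.conjLocal P (ρBQ.comp (toUnramifiedQuot F 𝒟.S)) v =
      conjHom P (ρBQ.comp (coneι 𝒟 V)) :=
    MonoidHom.ext fun σ => by
      rw [NearlyOrdinaryDeformationRing.conjLocal_apply, conjHom_apply]
      rfl
  rw [hconjLocal, hρv, hρBQ,
    liftDiff_conjHom_liftOfCoboundary hI hs (𝓡.modPowQuot n) (coneι 𝒟 V) N ρ'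
      (noFrameModPow_conj_localModPow 𝓡 n V)]
  -- the third cone equation, pulled back to `M₂(I_u)`
  have hβ : sectionDiff (su 𝓡 Θ hΘ n hn0 u) (frameSection (su 𝓡 Θ hΘ n hn0 u) N (su 𝓡 Θ hΘ n hn0 u N)) ρ' σ =
      (((P⁻¹ : GL (Fin 2) _)) : Matrix (Fin 2) (Fin 2) _) * kerMatrixLift Θ n u hJn hu (a (coneι 𝒟 V σ)) *
          (P : Matrix (Fin 2) (Fin 2) _) -
        kerMatrixLift Θ n u hJn hu (av V σ) +
        ((su 𝓡 Θ hΘ n hn0 u (ρ' σ) : Matrix (Fin 2) (Fin 2) _) * wt *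
            (((su 𝓡 Θ hΘ n hn0 u (ρ' σ))⁻¹ : GL (Fin 2) _) : Matrix (Fin 2) (Fin 2) _) - wt) := by
    have hsu'' : ∀ g, Matrix.GeneralLinearGroup.map (quHom 𝓡 Θ hΘ n u)
        (frameSection (su 𝓡 Θ hΘ n hn0 u) N (su 𝓡 Θ hΘ n hn0 u N) g) = g :=
      map_frameSection hs N _ (hs N)
    have h1 : (((P⁻¹ : GL (Fin 2) _)) : Matrix (Fin 2) (Fin 2) _) *
        kerMatrixLift Θ n u hJn hu (a (coneι 𝒟 V σ)) * (P : Matrix (Fin 2) (Fin 2) _) ∈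
          kerMatrix (quHom 𝓡 Θ hΘ n u) :=
      mul_mem_kerMatrix_right _ (mul_mem_kerMatrix_left _ (hmem _))
    have h2 : (su 𝓡 Θ hΘ n hn0 u (ρ' σ) : Matrix (Fin 2) (Fin 2) _) * wt *
        (((su 𝓡 Θ hΘ n hn0 u (ρ' σ))⁻¹ : GL (Fin 2) _) : Matrix (Fin 2) (Fin 2) _) ∈
          kerMatrix (quHom 𝓡 Θ hΘ n u) :=
      mul_mem_kerMatrix_right _ (mul_mem_kerMatrix_left _ (hmem _))
    refine eq_of_map_coeffFunPush_eq Θ hΘ n hn0 u hJn (sectionDiff_mem hs hsu'' ρ' σ)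
      ((kerMatrix _).add_mem ((kerMatrix _).sub_mem h1 (hmem _)) ((kerMatrix _).sub_mem h2 (hmem _))) ?_
    rw [map_sectionDiff_su 𝓡 Θ hΘ n hn0 u hJn V σ]
    have h3 := hlc2 σ
    simp only [coneCochainOf_snd_snd] at h3
    rw [h3, map_add_of_mem_kerMatrix hΛ ((kerMatrix _).sub_mem h1 (hmem _)) ((kerMatrix _).sub_mem h2 (hmem _)),
      map_sub_of_mem_kerMatrix hΛ h1 (hmem _), map_sub_of_mem_kerMatrix hΛ h2 (hmem _),
      map_conj_inv_of_mem_kerMatrix hΛ _ (hmem _), map_conj_of_mem_kerMatrix hΛ _ (hmem _),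
      map_pushResidue_su, map_pushResidue_su, map_coeffFunPush_kerMatrixLift,
      map_coeffFunPush_kerMatrixLift, map_coeffFunPush_kerMatrixLift]
    rfl
  rw [hβ]
  simp only [Matrix.mul_neg, Matrix.neg_mul, zero_add]
  abel

end Vanishing

end NearlyOrdinaryPresentationCA

end Literature.NumberTheory.GaloisRepresentations
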